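import Mathlib
import Summits.NavierStokesRegularity.NavierStokesRegularity.Theorems.RootDecompLitSliceClockFiveEighths
import HarnessLib

/-!
# Route RootDecompLitSlice — cell Uᶜ `CritTameScarIsCritical` (stmt-NavierStokesRegularity-31733):
# ON THE CELL'S OWN CLASS (the √-clock, `b = 1/2`) scars have order `≥ 16/19`

Helper toward the Tao-vacuous cell Uᶜ (`--supports 31733`; no item, no node, no registered stub).
The closed support item HV♯ `FourFifthsVisibleScar` ⟨27391⟩ (`Theorems.fourFifthsVisibleScar`) is
the one-window law `ClockScarLaw.uniformClockScarRung` at the √-clock: scar order `4b/(b+2) = 4/5`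
at `b = 1/2`. ONE bootstrap step through the landed uniform scar law
`LocalEnergyBudget.scar_le_uniform` (localised energy budget, Laplacian / cubic-flux /
global-pressure numbers discharged) improves it to `16/19`: exact one-step optimum of the crude
dial at `b = 1/2` (`γ = 32/19`, `θ = 5/19`; binding terms: window level, release cross term,
pressure flux), realised by the INTEGER scales `r = s¹⁹`, window `τ = s³²`, cutoff radius `ρ = s⁵`
(base law `∫_{B_{3ρ}}|u(T)|² ≤ C ρ^{4/5} = C s⁴`, clock level `H = K √τ = K s¹⁶`): every budget term
is `≤ const · s^k`, `k ∈ {16, 16, 22, 32, 18, 16, 32}`, i.e. `∫_{B_r}|u(T)|² ≤ M s¹⁶ = M r^{16/19}`.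

* ★ `ClockThreshold.uniformScar_sixteenNineteenths_of_sqrtClock` — classical Leray–Hopf frame +
  the √-clock `‖u(t) − u(T)‖₂² ≤ K √(T−t)`: `∃ M r₁ > 0, ∀ x₀, ∀ r < r₁, ∫_{B(x₀,r)}|u(T)|² ≤
  M r^{16/19}` (uniform in the centre);
* ★ `ClockThreshold.sixteenNineteenthsVisibleScar` — HV♯'s frame and shape VERBATIM with `4/5`
  replaced by `16/19`: the scar-order floor of the critically-tame class rises `4/5 → 16/19`
  (iterating the step converges to `0.8441…`; the crude tier never reaches order `1` at `b = 1/2`).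

HONEST FRAMING: helper lemmas INSIDE the Tao-vacuous cell Uᶜ; zero load of the route moves
(ROOT ⟺ U ∧ P1); no item is re-typed; the item `CritTameScarIsCritical` (scar order `1` on the
√-clock) stays OPEN — this is a rung in the cell's own currency (scar order at the endpoint
`b = 1/2`), ASIDE-kind under the named-rung rule. Rung 0: nothing here proves NS regularity.
Decomp-ns route-writer g40. [cite: CaffarelliKohnNirenberg1982, §2 eq. (2.4)]
-/

set_option linter.dupNamespace false

noncomputable section

namespace Summit.NavierStokesRegularity.NavierStokesRegularity.Theorems

open MeasureTheory TopologicalSpace Set Function Filter Metric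
open _root_.Topology
open scoped Laplacian InnerProductSpace RealInnerProductSpace ENNReal NNReal ContDiff
open Literature.Analysis.FluidPDE

namespace ClockThreshold

set_option maxHeartbeats 1600000 in
/-- ★ **Uniform scars of order `16/19` on the √-clock.** Frame: `ν > 0`, classical on
`[0,T) × ℝ³`, Leray–Hopf on `[0,T]` from decaying data, and the √-clock
`‖u(t) − u(T)‖₂² ≤ K √(T−t)` near `T` (the clock of the cell Uᶜ). Then
`∫_{B(x₀,r)}|u(T)|² ≤ M r^{16/19}` for all centres `x₀` and all `r < r₁` — ONE bootstrap step
(uniform scar law `LocalEnergyBudget.scar_le_uniform` at the scales `r = s¹⁹, τ = s³², ρ = s⁵`)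
from the base law `ClockScarLaw.uniformClockScarRung` (`α₀ = 4/5`).
[cite: CaffarelliKohnNirenberg1982, §2 eq. (2.4)] -/
theorem uniformScar_sixteenNineteenths_of_sqrtClock :
    ∀ (ν T : ℝ), 0 < ν → 0 < T →
    ∀ (u : ℝ → EuclideanSpace ℝ (Fin 3) → EuclideanSpace ℝ (Fin 3))
      (p : ℝ → EuclideanSpace ℝ (Fin 3) → ℝ),
      IsClassicalNSSolutionOn (Set.Ico 0 T) ν 0 u p →
      IsLerayHopfOn T ν 0 (u 0) u →
      HasRapidSpatialDecay (u 0) →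
      (∃ K T₁ : ℝ, T₁ < T ∧ ∀ t ∈ Set.Ioo T₁ T,
        ∫⁻ x, ‖u t x - u T x‖ₑ ^ 2 ≤ ENNReal.ofReal (K * Real.sqrt (T - t))) →
      ∃ M r₁ : ℝ, 0 < r₁ ∧ ∀ (x₀ : EuclideanSpace ℝ (Fin 3)), ∀ r ∈ Set.Ioo 0 r₁,
        ∫ x in ball x₀ r, ‖u T x‖ ^ 2 ≤ M * r ^ (16 / 19 : ℝ) := by
  intro ν T hν hT u p hcl hLH hdec hclock
  -- the base law `α₀ = 4/5` (clock in `rpow` form)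
  have hclock' : ∃ K T₁ : ℝ, T₁ < T ∧ ∀ t ∈ Set.Ioo T₁ T,
      ∫⁻ x, ‖u t x - u T x‖ₑ ^ 2 ≤ ENNReal.ofReal (K * (T - t) ^ (1 / 2 : ℝ)) := by
    obtain ⟨K, T₁, h1, h2⟩ := hclock
    exact ⟨K, T₁, h1, fun t ht => by rw [← Real.sqrt_eq_rpow]; exact h2 t ht⟩
  obtain ⟨C₁, R₁, hR₁, hbase⟩ := ClockScarLaw.uniformClockScarRung (b := 1 / 2) (by norm_num)
    (by norm_num) ν T hν hT u p hcl hLH hdec hclock'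
  obtain ⟨K, T₁, hT₁, hK⟩ := hclock
  obtain ⟨c₀, K₀, K₁, hc₀, hK₀, hK₁, hU⟩ := LocalEnergyBudget.scar_le_uniform
  obtain ⟨Cg, CL, hCg, hCL, hcut⟩ := exists_centredCutoff
  set K' : ℝ := max K 0 with hK'def
  have hK'0 : 0 ≤ K' := le_max_right _ _
  set C₁' : ℝ := max C₁ 0 with hC₁'def
  have hC₁'0 : 0 ≤ C₁' := le_max_right _ _
  set E : ℝ := ∫ x, ‖u 0 x‖ ^ 2 with hEdef
  have hE0 : 0 ≤ E := integral_nonneg fun x => by positivity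
  set D : ℝ := 2 * K' + 2 * (C₁' * (3 : ℝ) ^ (4 / 5 : ℝ)) with hDdef
  have hD0 : 0 ≤ D := by positivity
  set Gc : ℝ := Real.sqrt E * Real.sqrt K' / ν with hGcdef
  have hGc0 : 0 ≤ Gc := by positivity
  set M : ℝ := 2 * K' + 32 * K' / ν + 32 * Real.sqrt K' * Real.sqrt D / ν + 8 * CL * D +
    8 * Cg * K₀ / ν * D ^ (3 / 4 : ℝ) * Gc ^ (3 / 4 : ℝ) +
    16 * Cg * K₁ * Real.sqrt E / ν * D ^ (1 / 4 : ℝ) * Gc ^ (3 / 4 : ℝ) + c₀ * (K' + C₁') with hMdef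
  -- the admissible scale `s₁`
  set s₁ : ℝ := min (1 / 4) (min (R₁ / 3) (min (T - T₁) T)) with hs₁def
  have hs₁0 : 0 < s₁ := lt_min (by norm_num) (lt_min (by positivity) (lt_min (sub_pos.2 hT₁) hT))
  have hs₁4 : s₁ ≤ 1 / 4 := min_le_left _ _
  have hs₁R : s₁ ≤ R₁ / 3 := (min_le_right _ _).trans (min_le_left _ _)
  have hs₁T₁ : s₁ ≤ T - T₁ := (min_le_right _ _).trans ((min_le_right _ _).trans (min_le_left _ _))
  have hs₁T : s₁ ≤ T := (min_le_right _ _).trans ((min_le_right _ _).trans (min_le_right _ _))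
  refine ⟨M, s₁ ^ 19, by positivity, fun x₀ r hr => ?_⟩
  have hr0 : 0 < r := hr.1
  -- the basic scale `s = r^{1/19}`
  set s : ℝ := r ^ (1 / 19 : ℝ) with hsdef
  have hs0 : 0 < s := Real.rpow_pos_of_pos hr0 _
  have hsp : ∀ (n m : ℕ) (e : ℝ), (n : ℝ) * e = m → (s ^ n) ^ e = s ^ m := by
    intro n m e h
    rw [← Real.rpow_natCast s n, ← Real.rpow_mul hs0.le, h, Real.rpow_natCast]
  have hs19 : s ^ 19 = r := by
    rw [hsdef, ← Real.rpow_natCast, ← Real.rpow_mul hr0.le]; norm_num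
  have hss₁ : s < s₁ := by
    have h1 : r ^ (1 / 19 : ℝ) < (s₁ ^ 19) ^ (1 / 19 : ℝ) :=
      Real.rpow_lt_rpow hr0.le hr.2 (by norm_num)
    rwa [← Real.rpow_natCast s₁ 19, ← Real.rpow_mul hs₁0.le,
      show ((19 : ℕ) : ℝ) * (1 / 19 : ℝ) = 1 by norm_num, Real.rpow_one] at h1
  have hs4 : s ≤ 1 / 4 := hss₁.le.trans hs₁4
  have hs1 : s ≤ 1 := hs4.trans (by norm_num)
  have hsle : ∀ {n m : ℕ}, m ≤ n → s ^ n ≤ s ^ m := fun h => pow_le_pow_of_le_one hs0.le hs1 h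
  have hspow1 : ∀ {n : ℕ}, n ≠ 0 → s ^ n ≤ s := fun h => pow_le_of_le_one hs0.le hs1 h
  -- the scales
  set τ : ℝ := s ^ 32 with hτdef
  set ρ : ℝ := s ^ 5 with hρdef
  have hτ0 : 0 < τ := by positivity
  have hρ0 : 0 < ρ := by positivity
  have hτT₁ : τ < T - T₁ := lt_of_le_of_lt (hspow1 (by norm_num)) (hss₁.trans_le hs₁T₁)
  have hτT : τ < T := lt_of_le_of_lt (hspow1 (by norm_num)) (hss₁.trans_le hs₁T)
  have hρR₁ : 3 * ρ < R₁ := by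
    have : ρ ≤ s := hspow1 (by norm_num)
    linarith [hss₁.trans_le hs₁R]
  have hρR₁' : ρ < R₁ := by linarith
  have h4r : 4 * s ^ 19 ≤ ρ := by
    have h1 : s ^ 14 ≤ 1 / 4 := (hspow1 (by norm_num)).trans hs4
    calc 4 * s ^ 19 = s ^ 5 * (4 * s ^ 14) := by ring
      _ ≤ s ^ 5 * 1 := mul_le_mul_of_nonneg_left (by linarith) (pow_pos hs0 5).le
      _ = ρ := by rw [hρdef, mul_one]
  -- the clock level on the window
  set H : ℝ := K' * s ^ 16 with hHdef
  have hH0 : 0 ≤ H := by positivity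
  have hmod : ∀ t ∈ Set.Ico (T - τ) T, ∫⁻ x, ‖u t x - u T x‖ₑ ^ 2 ≤ ENNReal.ofReal H := by
    intro t ht
    have htT₁ : T₁ < t := by linarith [ht.1]
    have h0t : 0 ≤ T - t := by linarith [ht.2]
    refine (hK t ⟨htT₁, ht.2⟩).trans (ENNReal.ofReal_le_ofReal ?_)
    have h1 : Real.sqrt (T - t) ≤ Real.sqrt τ := Real.sqrt_le_sqrt (by linarith [ht.1])
    have h2 : Real.sqrt τ = s ^ 16 := by
      rw [hτdef, show s ^ 32 = (s ^ 16) ^ 2 by ring, Real.sqrt_sq (by positivity)]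
    calc K * Real.sqrt (T - t) ≤ K' * Real.sqrt (T - t) :=
          mul_le_mul_of_nonneg_right (le_max_left _ _) (Real.sqrt_nonneg _)
      _ ≤ K' * Real.sqrt τ := mul_le_mul_of_nonneg_left h1 hK'0
      _ = H := by rw [h2]
  -- the cutoff
  obtain ⟨φ, hφ, hφc, hφ0, hφ1, hone, hsupp, hDφ, hΔφ⟩ := hcut x₀ ρ hρ0
  -- THE UNIFORM SCAR LAW at these scales
  have hINEQ := hU ν T hν hT u p hcl hLH hdec x₀ (s ^ 19) ρ (3 * ρ) τ H (by positivity) h4r hτ0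
    hτT hH0 hmod φ (Cg / ρ) (CL / ρ ^ 2) hφ hφc hφ0 hφ1 hone hsupp hDφ hΔφ (by positivity)
  -- the base law at `3ρ` and at `ρ`
  set m3 : ℝ := ∫ x in ball x₀ (3 * ρ), ‖u T x‖ ^ 2 with hm3
  set mρ : ℝ := ∫ x in ball x₀ ρ, ‖u T x‖ ^ 2 with hmρ
  have hm3_0 : 0 ≤ m3 := integral_nonneg fun x => by positivity
  have hmρ_0 : 0 ≤ mρ := integral_nonneg fun x => by positivity
  have hexp : (4 * (1 / 2 : ℝ) / (1 / 2 + 2)) = 4 / 5 := by norm_num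
  have hρpow : ρ ^ (4 / 5 : ℝ) = s ^ 4 := hsp 5 4 _ (by norm_num)
  have hm3le : m3 ≤ C₁' * (3 : ℝ) ^ (4 / 5 : ℝ) * s ^ 4 := by
    have h1 := hbase x₀ (3 * ρ) ⟨by positivity, hρR₁⟩
    rw [hexp, Real.mul_rpow (by norm_num) hρ0.le, hρpow] at h1
    refine h1.trans ?_
    have : C₁ * ((3 : ℝ) ^ (4 / 5 : ℝ) * s ^ 4) ≤ C₁' * ((3 : ℝ) ^ (4 / 5 : ℝ) * s ^ 4) :=
      mul_le_mul_of_nonneg_right (le_max_left _ _) (by positivity)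
    linarith
  have hmρle : mρ ≤ C₁' * s ^ 4 := by
    have h1 := hbase x₀ ρ ⟨hρ0, hρR₁'⟩
    rw [hexp, hρpow] at h1
    exact h1.trans (mul_le_mul_of_nonneg_right (le_max_left _ _) (by positivity))
  -- the window quantities
  have hsqrtH : Real.sqrt H = Real.sqrt K' * s ^ 8 := by
    rw [hHdef, show s ^ 16 = (s ^ 8) ^ 2 by ring, Real.sqrt_mul' _ (sq_nonneg _),
      Real.sqrt_sq (by positivity)]
  have hp16_4 : s ^ 16 ≤ s ^ 4 := hsle (by norm_num)
  have hHle : H ≤ K' * s ^ 4 := by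
    rw [hHdef]; exact mul_le_mul_of_nonneg_left hp16_4 hK'0
  have h2Hm : 2 * H + 2 * m3 ≤ D * s ^ 4 := by
    calc 2 * H + 2 * m3 ≤ 2 * (K' * s ^ 4) + 2 * (C₁' * (3 : ℝ) ^ (4 / 5 : ℝ) * s ^ 4) :=
          add_le_add (by linarith) (by linarith)
      _ = D * s ^ 4 := by rw [hDdef]; ring
  set A : ℝ := (Real.sqrt H + Real.sqrt m3) ^ 2 with hAdef
  have hA0 : 0 ≤ A := sq_nonneg _
  have hAle : A ≤ D * s ^ 4 := by
    have h1 : A ≤ 2 * H + 2 * m3 := by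
      rw [hAdef]
      nlinarith [sq_nonneg (Real.sqrt H - Real.sqrt m3), Real.sq_sqrt hH0, Real.sq_sqrt hm3_0]
    exact h1.trans h2Hm
  have hA34 : A ^ (3 / 4 : ℝ) ≤ D ^ (3 / 4 : ℝ) * s ^ 3 := by
    calc A ^ (3 / 4 : ℝ) ≤ (D * s ^ 4) ^ (3 / 4 : ℝ) := Real.rpow_le_rpow hA0 hAle (by norm_num)
      _ = D ^ (3 / 4 : ℝ) * s ^ 3 := by
          rw [Real.mul_rpow hD0 (by positivity), hsp 4 3 _ (by norm_num)]
  have hA14 : A ^ (1 / 4 : ℝ) ≤ D ^ (1 / 4 : ℝ) * s ^ 1 := by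
    calc A ^ (1 / 4 : ℝ) ≤ (D * s ^ 4) ^ (1 / 4 : ℝ) := Real.rpow_le_rpow hA0 hAle (by norm_num)
      _ = D ^ (1 / 4 : ℝ) * s ^ 1 := by
          rw [Real.mul_rpow hD0 (by positivity), hsp 4 1 _ (by norm_num)]
  have hsqrt2 : Real.sqrt (2 * H + 2 * m3) ≤ Real.sqrt D * s ^ 2 := by
    calc Real.sqrt (2 * H + 2 * m3) ≤ Real.sqrt (D * (s ^ 2) ^ 2) :=
          Real.sqrt_le_sqrt (by rw [show (s ^ 2) ^ 2 = s ^ 4 by ring]; exact h2Hm)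
      _ = Real.sqrt D * s ^ 2 := by
          rw [Real.sqrt_mul' _ (sq_nonneg _), Real.sqrt_sq (by positivity)]
  have hG : Real.sqrt E * Real.sqrt H / ν = Gc * s ^ 8 := by
    rw [hsqrtH, hGcdef]; ring
  have hG34 : (Real.sqrt E * Real.sqrt H / ν) ^ (3 / 4 : ℝ) = Gc ^ (3 / 4 : ℝ) * s ^ 6 := by
    rw [hG, Real.mul_rpow hGc0 (by positivity), hsp 8 6 _ (by norm_num)]
  have hτ14 : τ ^ (1 / 4 : ℝ) = s ^ 8 := hsp 32 8 _ (by norm_num)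
  have hν0 : ν ≠ 0 := hν.ne'
  have hs0' : s ≠ 0 := hs0.ne'
  -- TERM BY TERM
  -- (1) window level
  have hT1 : 2 * H = 2 * K' * s ^ 16 := by rw [hHdef]; ring
  -- (2) release
  have hT2 : 16 * ((s ^ 19) ^ 2 / (ν * τ)) *
      ((4 * H + 4 * Real.sqrt H * Real.sqrt (2 * H + 2 * m3)) / 2) ≤
      32 * K' / ν * s ^ 22 + 32 * Real.sqrt K' * Real.sqrt D / ν * s ^ 16 := by
    have e : 16 * ((s ^ 19) ^ 2 / (ν * τ)) *
        ((4 * H + 4 * Real.sqrt H * Real.sqrt (2 * H + 2 * m3)) / 2) =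
        32 * K' / ν * s ^ 22 +
          32 * Real.sqrt K' / ν * s ^ 14 * Real.sqrt (2 * H + 2 * m3) := by
      rw [hsqrtH, hHdef, hτdef]
      field_simp
      ring
    rw [e]
    have h1 : 32 * Real.sqrt K' / ν * s ^ 14 * Real.sqrt (2 * H + 2 * m3) ≤
        32 * Real.sqrt K' / ν * s ^ 14 * (Real.sqrt D * s ^ 2) :=
      mul_le_mul_of_nonneg_left hsqrt2 (by positivity)
    have h2 : 32 * Real.sqrt K' / ν * s ^ 14 * (Real.sqrt D * s ^ 2) =
        32 * Real.sqrt K' * Real.sqrt D / ν * s ^ 16 := by ring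
    linarith
  -- (3) Laplacian
  have hT3 : 16 * ((s ^ 19) ^ 2 / (ν * τ)) * ((ν * (CL / ρ ^ 2) * A * τ) / 2) ≤
      8 * CL * D * s ^ 32 := by
    have e : 16 * ((s ^ 19) ^ 2 / (ν * τ)) * ((ν * (CL / ρ ^ 2) * A * τ) / 2) =
        8 * CL * s ^ 28 * A := by
      rw [hτdef, hρdef]
      field_simp
      ring
    rw [e]
    calc 8 * CL * s ^ 28 * A ≤ 8 * CL * s ^ 28 * (D * s ^ 4) :=
          mul_le_mul_of_nonneg_left hAle (by positivity)
      _ = 8 * CL * D * s ^ 32 := by ring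
  -- (4) cubic flux
  have hT4 : 16 * ((s ^ 19) ^ 2 / (ν * τ)) *
      ((Cg / ρ * (K₀ * A ^ (3 / 4 : ℝ) * (τ ^ (1 / 4 : ℝ) *
        (Real.sqrt E * Real.sqrt H / ν) ^ (3 / 4 : ℝ)))) / 2) ≤
      8 * Cg * K₀ / ν * D ^ (3 / 4 : ℝ) * Gc ^ (3 / 4 : ℝ) * s ^ 18 := by
    rw [hτ14, hG34]
    have e : 16 * ((s ^ 19) ^ 2 / (ν * τ)) *
        ((Cg / ρ * (K₀ * A ^ (3 / 4 : ℝ) * (s ^ 8 * (Gc ^ (3 / 4 : ℝ) * s ^ 6)))) / 2) =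
        8 * Cg * K₀ / ν * Gc ^ (3 / 4 : ℝ) * s ^ 15 * A ^ (3 / 4 : ℝ) := by
      rw [hτdef, hρdef]
      field_simp
      try ring
    rw [e]
    calc 8 * Cg * K₀ / ν * Gc ^ (3 / 4 : ℝ) * s ^ 15 * A ^ (3 / 4 : ℝ)
        ≤ 8 * Cg * K₀ / ν * Gc ^ (3 / 4 : ℝ) * s ^ 15 * (D ^ (3 / 4 : ℝ) * s ^ 3) :=
          mul_le_mul_of_nonneg_left hA34 (by positivity)
      _ = 8 * Cg * K₀ / ν * D ^ (3 / 4 : ℝ) * Gc ^ (3 / 4 : ℝ) * s ^ 18 := by ring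
  -- (5) pressure flux
  have hT5 : 16 * ((s ^ 19) ^ 2 / (ν * τ)) *
      ((2 * (Cg / ρ) * (K₁ * Real.sqrt E * A ^ (1 / 4 : ℝ) * (τ ^ (1 / 4 : ℝ) *
        (Real.sqrt E * Real.sqrt H / ν) ^ (3 / 4 : ℝ)))) / 2) ≤
      16 * Cg * K₁ * Real.sqrt E / ν * D ^ (1 / 4 : ℝ) * Gc ^ (3 / 4 : ℝ) * s ^ 16 := by
    rw [hτ14, hG34]
    have e : 16 * ((s ^ 19) ^ 2 / (ν * τ)) *
        ((2 * (Cg / ρ) * (K₁ * Real.sqrt E * A ^ (1 / 4 : ℝ) *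
          (s ^ 8 * (Gc ^ (3 / 4 : ℝ) * s ^ 6)))) / 2) =
        16 * Cg * K₁ * Real.sqrt E / ν * Gc ^ (3 / 4 : ℝ) * s ^ 15 * A ^ (1 / 4 : ℝ) := by
      rw [hτdef, hρdef]
      field_simp
      try ring
    rw [e]
    calc 16 * Cg * K₁ * Real.sqrt E / ν * Gc ^ (3 / 4 : ℝ) * s ^ 15 * A ^ (1 / 4 : ℝ)
        ≤ 16 * Cg * K₁ * Real.sqrt E / ν * Gc ^ (3 / 4 : ℝ) * s ^ 15 * (D ^ (1 / 4 : ℝ) * s ^ 1) :=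
          mul_le_mul_of_nonneg_left hA14 (by positivity)
      _ = 16 * Cg * K₁ * Real.sqrt E / ν * D ^ (1 / 4 : ℝ) * Gc ^ (3 / 4 : ℝ) * s ^ 16 := by ring
  -- (6) mean part
  have hT6 : c₀ * (s ^ 19 / ρ) ^ 2 * (H + mρ) ≤ c₀ * (K' + C₁') * s ^ 32 := by
    have e : c₀ * (s ^ 19 / ρ) ^ 2 * (H + mρ) = c₀ * s ^ 28 * (H + mρ) := by
      rw [hρdef]
      field_simp
      try ring
    rw [e]
    have h1 : H + mρ ≤ (K' + C₁') * s ^ 4 := by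
      calc H + mρ ≤ K' * s ^ 4 + C₁' * s ^ 4 := add_le_add hHle hmρle
        _ = (K' + C₁') * s ^ 4 := by ring
    calc c₀ * s ^ 28 * (H + mρ) ≤ c₀ * s ^ 28 * ((K' + C₁') * s ^ 4) :=
          mul_le_mul_of_nonneg_left h1 (by positivity)
      _ = c₀ * (K' + C₁') * s ^ 32 := by ring
  -- powers of `s` down to `s^16`
  have hp22 : s ^ 22 ≤ s ^ 16 := hsle (by norm_num)
  have hp32 : s ^ 32 ≤ s ^ 16 := hsle (by norm_num)
  have hp18 : s ^ 18 ≤ s ^ 16 := hsle (by norm_num)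
  have hp16' : s ^ 16 ≤ s ^ 16 := hsle (by norm_num)
  -- assemble
  have hsplit : ∀ (P X Y Z W V : ℝ), P * ((X + (Y + Z + W)) / 2) + V =
      P * (X / 2) + P * (Y / 2) + P * (Z / 2) + P * (W / 2) + V := fun P X Y Z W V => by ring
  have hr16 : r ^ (16 / 19 : ℝ) = s ^ 16 := by
    rw [← hs19]; exact hsp 19 16 _ (by norm_num)
  rw [hr16, ← hs19]
  refine hINEQ.trans ?_
  rw [add_assoc, hsplit]
  have c2 : 0 ≤ 32 * K' / ν := by positivity
  have c3 : 0 ≤ 8 * CL * D := by positivity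
  have c4 : 0 ≤ 8 * Cg * K₀ / ν * D ^ (3 / 4 : ℝ) * Gc ^ (3 / 4 : ℝ) := by positivity
  have c5 : 0 ≤ 16 * Cg * K₁ * Real.sqrt E / ν * D ^ (1 / 4 : ℝ) * Gc ^ (3 / 4 : ℝ) := by
    positivity
  have c6 : 0 ≤ c₀ * (K' + C₁') := by positivity
  have hMs : M * s ^ 16 = 2 * K' * s ^ 16 + ((32 * K' / ν * s ^ 16 +
      32 * Real.sqrt K' * Real.sqrt D / ν * s ^ 16) + 8 * CL * D * s ^ 16 +
      8 * Cg * K₀ / ν * D ^ (3 / 4 : ℝ) * Gc ^ (3 / 4 : ℝ) * s ^ 16 +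
      16 * Cg * K₁ * Real.sqrt E / ν * D ^ (1 / 4 : ℝ) * Gc ^ (3 / 4 : ℝ) * s ^ 16 +
      c₀ * (K' + C₁') * s ^ 16) := by rw [hMdef]; ring
  rw [hMs]
  have hT5' := hT5.trans (mul_le_mul_of_nonneg_left hp16' c5)
  gcongr ?_ + (?_ + ?_ + ?_ + ?_ + ?_)
  all_goals first
    | exact le_of_eq hT1
    | exact hT2.trans (add_le_add (mul_le_mul_of_nonneg_left hp22 c2) le_rfl)
    | exact hT3.trans (mul_le_mul_of_nonneg_left hp32 c3)
    | exact hT4.trans (mul_le_mul_of_nonneg_left hp18 c4)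
    | exact hT5'
    | exact hT6.trans (mul_le_mul_of_nonneg_left hp32 c6)

/-- ★ **HV♯ IMPROVED: the scar-order floor of the critically-tame class is `16/19`.** The frame
and shape of the closed support item `FourFifthsVisibleScar` ⟨27391⟩ VERBATIM with the exponent
`4/5` replaced by `16/19 > 4/5`. [cite: CaffarelliKohnNirenberg1982, §2 eq. (2.4)] -/
theorem sixteenNineteenthsVisibleScar :
    ∀ (ν T : ℝ), 0 < ν → 0 < T →
    ∀ (u : ℝ → EuclideanSpace ℝ (Fin 3) → EuclideanSpace ℝ (Fin 3))
      (p : ℝ → EuclideanSpace ℝ (Fin 3) → ℝ),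
      IsClassicalNSSolutionOn (Set.Ico 0 T) ν 0 u p →
      IsLerayHopfOn T ν 0 (u 0) u →
      HasRapidSpatialDecay (u 0) →
      (∃ K T₁ : ℝ, T₁ < T ∧ ∀ t ∈ Set.Ioo T₁ T,
        ∫⁻ x, ‖u t x - u T x‖ₑ ^ 2 ≤ ENNReal.ofReal (K * Real.sqrt (T - t))) →
      ∀ x₀ : EuclideanSpace ℝ (Fin 3), ∃ C r₁ : ℝ, 0 < r₁ ∧ ∀ r ∈ Set.Ioo 0 r₁,
        ∫ x in Metric.ball x₀ r, ‖u T x‖ ^ 2 ≤ C * r ^ (16 / 19 : ℝ) := by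
  intro ν T hν hT u p hcl hLH hdec hclock x₀
  obtain ⟨M, r₁, hr₁, hM⟩ := uniformScar_sixteenNineteenths_of_sqrtClock ν T hν hT u p hcl hLH hdec
    hclock
  exact ⟨M, r₁, hr₁, fun r hr => hM x₀ r hr⟩

/-- The new floor dominates HV♯: order `16/19` implies order `4/5` near `r = 0`
(`r^{16/19} ≤ r^{4/5}` for `r ≤ 1`; `C ↦ max C 0`, `r₁ ↦ min r₁ 1`). [folklore] -/
theorem fourFifths_of_sixteenNineteenths
    {u : ℝ → EuclideanSpace ℝ (Fin 3) → EuclideanSpace ℝ (Fin 3)} {T : ℝ}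
    {x₀ : EuclideanSpace ℝ (Fin 3)}
    (h : ∃ C r₁ : ℝ, 0 < r₁ ∧ ∀ r ∈ Set.Ioo 0 r₁,
      ∫ x in Metric.ball x₀ r, ‖u T x‖ ^ 2 ≤ C * r ^ (16 / 19 : ℝ)) :
    ∃ C r₁ : ℝ, 0 < r₁ ∧ ∀ r ∈ Set.Ioo 0 r₁,
      ∫ x in Metric.ball x₀ r, ‖u T x‖ ^ 2 ≤ C * r ^ (4 / 5 : ℝ) := by
  obtain ⟨C, r₁, hr₁, hC⟩ := h
  refine ⟨max C 0, min r₁ 1, lt_min hr₁ one_pos, fun r hr => ?_⟩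
  have hr0 : 0 < r := hr.1
  have hr1 : r ≤ 1 := hr.2.le.trans (min_le_right _ _)
  have h1 := hC r ⟨hr0, lt_of_lt_of_le hr.2 (min_le_left _ _)⟩
  have hpow : r ^ (16 / 19 : ℝ) ≤ r ^ (4 / 5 : ℝ) :=
    Real.rpow_le_rpow_of_exponent_ge hr0 hr1 (by norm_num)
  calc ∫ x in Metric.ball x₀ r, ‖u T x‖ ^ 2 ≤ C * r ^ (16 / 19 : ℝ) := h1
    _ ≤ max C 0 * r ^ (16 / 19 : ℝ) :=
        mul_le_mul_of_nonneg_right (le_max_left _ _) (Real.rpow_nonneg hr0.le _)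
    _ ≤ max C 0 * r ^ (4 / 5 : ℝ) := mul_le_mul_of_nonneg_left hpow (le_max_right _ _)

end ClockThreshold

end Summit.NavierStokesRegularity.NavierStokesRegularity.Theorems

end
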